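import Summits.Ventures.PercRepro.Night2TwoOneFreeKernel
import Summits.Ventures.PercRepro.Night2TwoOneMass
import Summits.Ventures.PercRepro.Night2TwoOneSmall

/-!
# PercRepro — **THE CELL `(2, 1)` WITH AT LEAST TWO FAT CLOSURES, AT EVERY SIZE, NO OTHER HYPOTHESIS** (night-2, gen 28)

`Night2TwoOneGeneralCell` without the hypothesis «at most two fat closures»: (LI_G) holds at every rank-6 flat of the
cell `(2, 1)` with at least two fat closures (`localShadowHall_two_one_five_two_fat_free`,
**`localShadowHall_two_one_five_fatClosures_free`**).
-/

namespace PercRepro.Shadow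

open Finset PerFlat ThmH

variable {α : Type*} [DecidableEq α] {M : Matroid α} [M.Finite]

section FreeCell

variable {G : Finset α}

open scoped Classical in
/-- **THE CELL WITH DISJOINT MISSED PAIRS, ANY NUMBER OF FAT CLOSURES** (`|V| ≥ 9`). -/
theorem localShadowHall_two_one_five_two_fat_free_disjoint (hG : G ∈ flatsQ M (5 + 1))
    (hd : (gr M \ G).card = 2) (hk : kColoops M G = 1) (hs : ∀ e ∈ gr M, ∀ f ∈ gr M, e ≠ f → rkN M {e, f} = 2)
    (hl : ∀ e ∈ gr M, M.Indep {e}) (h9 : 9 ≤ (G \ coloops M G).card)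
    {B₀ B₁ : Finset α} (hB₀ : B₀ ∈ thinMembers M 5 G) (hB₁ : B₁ ∈ thinMembers M 5 G)
    (hm₀ : (G \ clF M B₀).card ≤ 2) (hm₁ : (G \ clF M B₁).card ≤ 2) (hne : clF M B₀ ≠ clF M B₁)
    (hdisj : Disjoint (G \ clF M B₀) (G \ clF M B₁)) :
    LocalShadowHall M 5 G := by
  have hd' : (gr M \ G).card ≤ 5 := by omega
  have hk' : kColoops M G + 5 = 5 + 1 := by omega
  have hKH₀ : coloops M G ⊆ clF M B₀ := (coloops_subset_of_mem_thinMembers hG hd' hB₀).trans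
    (subset_clF (mem_membersIn.1 (mem_thinMembers.1 hB₀).1).1)
  have hKH₁ : coloops M G ⊆ clF M B₁ := (coloops_subset_of_mem_thinMembers hG hd' hB₁).trans
    (subset_clF (mem_membersIn.1 (mem_thinMembers.1 hB₁).1).1)
  have hH₀G : clF M B₀ ⊆ G := (mem_membersIn.1 (mem_thinMembers.1 hB₀).1).2
  have hA2 : (G \ clF M B₀).card = 2 := by
    have := two_le_card_sdiff_of_not_lay0 hG hd' (mem_thinMembers.1 hB₀).1 (mem_thinMembers.1 hB₀).2
    omega
  have hB2 : (G \ clF M B₁).card = 2 := by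
    have := two_le_card_sdiff_of_not_lay0 hG hd' (mem_thinMembers.1 hB₁).1 (mem_thinMembers.1 hB₁).2
    omega
  set Xs := (G \ clF M B₀) ∪ (G \ clF M B₁) with hXs
  set P := (clF M B₀ ∩ clF M B₁) \ coloops M G with hPdef
  set n := (G \ coloops M G).card with hn
  have hXG : Xs ⊆ G := Finset.union_subset Finset.sdiff_subset Finset.sdiff_subset
  have hXs4 : Xs.card = 4 := by rw [hXs, Finset.card_union_of_disjoint hdisj, hA2, hB2]
  have hPV : P ⊆ G \ coloops M G :=
    Finset.sdiff_subset_sdiff (Finset.inter_subset_left.trans hH₀G) (Finset.Subset.refl _)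
  have hVP : (G \ coloops M G) \ P = Xs := by
    ext x
    constructor
    · intro hx
      rw [Finset.mem_sdiff, Finset.mem_sdiff] at hx
      exact mem_classes_of_notMem_plane hx.1.1 hx.1.2 hx.2
    · intro hx
      rw [Finset.mem_sdiff, Finset.mem_sdiff]
      rw [hXs, Finset.mem_union, Finset.mem_sdiff, Finset.mem_sdiff] at hx
      rcases hx with h | h
      · exact ⟨⟨h.1, fun hK => h.2 (hKH₀ hK)⟩, fun hP => h.2 (Finset.mem_inter.1 (Finset.mem_sdiff.1 hP).1).1⟩
      · exact ⟨⟨h.1, fun hK => h.2 (hKH₁ hK)⟩, fun hP => h.2 (Finset.mem_inter.1 (Finset.mem_sdiff.1 hP).1).2⟩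
  have hPcard : P.card = n - 4 := by
    have := Finset.card_sdiff_add_card_eq_card hPV
    rw [hVP, hXs4] at this
    omega
  have hdl := dload_comp_free_le_cap2 hG hd hk hs hB₀ hB₁ hm₀ hm₁ hdisj
  apply localShadowHall_of_comp (P := fun B => 5 ≤ (B \ coloops M G).card) hG hd' hXG
  · -- every lossy big pair has a completion target
    intro B hB _ z hz hl0
    obtain ⟨u, u', h₀, h₁⟩ := one_per_class_free hG hd hk hB₀ hB₁ hm₀ hm₁ hB hz hl0
    have hc := card_sdiff_classes_eq_two hdisj hA2 hB2 h₀ h₁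
    rw [← hXs] at hc
    rw [← Finset.card_pos, hc]
    norm_num
  · exact hdl
  · intro B hB hnP z hz
    by_cases hl0 : loss M 5 G B z = 0
    · rw [hl0]
      exact mul_nonneg (rhoL_nonneg hG hd' B z) (lossIncomeH_nonneg hG hd' hdl B z)
    · have hB4 : (B \ coloops M G).card + 1 = 5 := by
        have := card_sdiff_coloops_thin_ge hG hd' hk' hB
        omega
      obtain ⟨hXP3, hXP2, -, -, -⟩ :=
        profile_of_lossy_basis_pair hG hd hk hB₀ hB₁ hm₀ hm₁ hne hdisj hB hB4 hz hl0
      have hprof : profileAt (coloops M G) P (insert z B) = (3, 2) := by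
        simp only [profileAt]
        rw [hXP3, hXP2]
      apply basis_pair_fair_of_qSumW_two_one hG hd hk (by omega) hPV (cnt := cntTwoOne) (vFree_nonneg n)
        (eTwoOne_pos (by omega : 3 ≤ n)) hdl hB hnP hz hl0
      · intro T hT
        exact pi2MassH_le_plane_two_one hG hd hk hs hl h9 hB₀ hB₁ hm₀ hm₁ hne
          (subset_G_of_mem_shadowAt (mem_tgtSets.1 hT).1)
      · exact cap3_ge_vFree hG hd hk hs hB₀ hB₁ hm₀ hm₁ hne hdisj hB hB4 hz hl0
      · rw [hprof, hVP, hXs4, hPcard]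
        exact qSumW_free_ge_one h9

open scoped Classical in
/-- **THE CELL `(2, 1)` WITH TWO GIVEN FAT MEMBERS, `|V| ≥ 9`, NO OTHER HYPOTHESIS.** -/
theorem localShadowHall_two_one_five_two_fat_free (hG : G ∈ flatsQ M (5 + 1)) (hd : (gr M \ G).card = 2)
    (hk : kColoops M G = 1) (hs : ∀ e ∈ gr M, ∀ f ∈ gr M, e ≠ f → rkN M {e, f} = 2)
    (hl : ∀ e ∈ gr M, M.Indep {e}) (h9 : 9 ≤ (G \ coloops M G).card)
    {B₀ B₁ : Finset α} (hB₀ : B₀ ∈ thinMembers M 5 G) (hB₁ : B₁ ∈ thinMembers M 5 G)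
    (hm₀ : (G \ clF M B₀).card ≤ 2) (hm₁ : (G \ clF M B₁).card ≤ 2) (hne : clF M B₀ ≠ clF M B₁) :
    LocalShadowHall M 5 G := by
  by_cases hdisj : Disjoint (G \ clF M B₀) (G \ clF M B₁)
  · exact localShadowHall_two_one_five_two_fat_free_disjoint hG hd hk hs hl h9 hB₀ hB₁ hm₀ hm₁ hne hdisj
  · exact localShadowHall_two_one_five_two_fat_meet hG hd hk hB₀ hB₁ hm₀ hm₁ hne hdisj

open scoped Classical in
/-- **THE CELL IN THE RESIDUE VOCABULARY, EVERY `|V|`, AT LEAST TWO FAT CLOSURES.** -/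
theorem localShadowHall_two_one_five_fatClosures_free (hG : G ∈ flatsQ M (5 + 1))
    (hd : (gr M \ G).card = 2) (hk : kColoops M G = 1)
    (hs : ∀ e ∈ gr M, ∀ f ∈ gr M, e ≠ f → rkN M {e, f} = 2) (hl : ∀ e ∈ gr M, M.Indep {e})
    (h2 : 2 ≤ (fatClosures M 5 G 2).card) : LocalShadowHall M 5 G := by
  rcases Nat.lt_or_ge (G \ coloops M G).card 9 with h8 | h9
  · exact localShadowHall_of_small hG hd hk (by omega)
  · obtain ⟨H₀, hH₀, H₁, hH₁, hne⟩ := Finset.one_lt_card.1 (by omega : 1 < (fatClosures M 5 G 2).card)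
    unfold fatClosures at hH₀ hH₁
    obtain ⟨B₀, hB₀, rfl⟩ := Finset.mem_image.1 hH₀
    obtain ⟨B₁, hB₁, rfl⟩ := Finset.mem_image.1 hH₁
    rw [Finset.mem_filter] at hB₀ hB₁
    exact localShadowHall_two_one_five_two_fat_free hG hd hk hs hl h9 hB₀.1 hB₁.1 hB₀.2 hB₁.2 hne

end FreeCell

end PercRepro.Shadow
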